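import Summits.NavierStokesRegularity.NavierStokesRegularity.Theorems.ExtremiserTransienceNearExtremalTransienceExtremiserLiouvilleConstantSpeedSlidePalinstrophySecondOrder
import Summits.NavierStokesRegularity.NavierStokesRegularity.Theorems.ExtremiserTransienceNearExtremalTransienceExtremiserLiouvilleConstantSpeedSlideJetKinematicsIntegrated
import HarnessLib

/-!
# Crux `ExtremiserTransience.NearExtremalTransience` (stmt-NavierStokesRegularity-21883), line `extremiser_liouville`,
# stub K1b — THE `Z′`-LINE OF R6b: COERCIVITY OF `−Ĉ₁` UP TO LISTED LOWER-ORDER TERMS (record §15/§17/§18)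

`--supports stmt-NavierStokesRegularity-21883` (helper).  Author: prover seat `ns-el-k1b` (g9).

From the `D²v`-form of the palinstrophy variation (`…SlidePalinstrophySecondOrder`) and the integrated jet kinematics
(`…SlideJetKinematicsIntegrated`, `M²∫g′|∇∇_hV₂|² ≤ 2∫g′|Dv|⁴_F + 2σ²∫g′(|D∂₀v|²_F + |D∂₁v|²_F)`), for the constant-speed jet with
`‖v − c‖ ≤ σ` on `supp g′∘x₂`, `8σ² ≤ M²`, `g′ ≥ 0`:
```
  (M²/4)·Σₖ∫g′|D∂ₖv|²_F ≤ M²·(−Ĉ₁) + 2∫g′|Dv|⁴_F + M²·Err,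
  Err = ½|∫g‴|∇v₂|²| + ½|∫g‴‖ω‖²| + |∫g‴(∂₂v₂)²| + |∫d₄| + |∫d₅| + |∫Σd₆| + |∫d₈|
```
— the `Z′`-LINE IS COERCIVE in `|D²v|²_F = Σₖ|D∂ₖv|²_F` up to the quartic line (`…SlideLayerGradientL4`) and `g″/g‴`-weighted
first-order / first×second-order terms whose pointwise sizes are in `…SlideCubicBounds` (and `d₄` in (KIN) form in p737733).
* `palinstrophyLine_coercive` : the displayed inequality (`Ĉ₁` = the bracket of (INEQ)₃ verbatim).

WHAT THIS IS NOT: K1b is NOT proved; nothing here proves NS regularity. [folklore]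
-/

noncomputable section

open Set Filter Topology MeasureTheory Metric Function InnerProductSpace
open scoped ENNReal NNReal Topology InnerProductSpace RealInnerProductSpace ContDiff
open Literature.Analysis.FluidPDE Literature.Analysis

namespace Summit.NavierStokesRegularity.NavierStokesRegularity.Theorems

-- the problem directory repeats the summit name (`NavierStokesRegularity/NavierStokesRegularity`)
set_option linter.dupNamespace false

namespace ExtremiserLiouville

open DepletionLadder.KStar

variable {v : EuclideanSpace ℝ (Fin 3) → EuclideanSpace ℝ (Fin 3)} {c : EuclideanSpace ℝ (Fin 3)} {g : ℝ → ℝ}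

/-- **Coercivity of the `Z′`-line for the jet** (notation of the file header). [folklore] -/
theorem palinstrophyLine_coercive (hv : ContDiff ℝ ∞ v) (hdiv : VectorCalculus.IsDivFree v) {M : ℝ}
    (hM : ∀ x, ‖v x‖ = M) (hc0 : c 0 = 0) (hc1 : c 1 = 0) (hcM : ‖c‖ = M) {B : ℝ} (hB : ∀ x, ‖fderiv ℝ v x‖ ≤ B)
    (hg : ContDiff ℝ ∞ g) {K T σ : ℝ}
    (hK1 : ∀ s, |deriv g s| ≤ K) (hK2 : ∀ s, |deriv (deriv g) s| ≤ K) (hK3 : ∀ s, |deriv (deriv (deriv g)) s| ≤ K)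
    (hT3 : ∀ s, T ≤ |s| → deriv (deriv (deriv g)) s = 0) (hγ0 : ∀ s, 0 ≤ deriv g s)
    (hσM : 8 * σ ^ 2 ≤ M ^ 2) (hσ : ∀ x : EuclideanSpace ℝ (Fin 3), deriv g (x 2) ≠ 0 → ‖v x - c‖ ≤ σ)
    (h1 : ∫⁻ x, ‖iteratedFDeriv ℝ 1 v x‖ₑ ^ 2 < ⊤) (h2 : ∫⁻ x, ‖iteratedFDeriv ℝ 2 v x‖ₑ ^ 2 < ⊤)
    (hslab : Integrable (fun x => {x : EuclideanSpace ℝ (Fin 3) | |x 2| ≤ T}.indicator (fun x => ‖v x - c‖ ^ 2) x) volume) :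
    (M ^ 2 / 4) * (∫ x : EuclideanSpace ℝ (Fin 3), deriv g (x 2) * ∑ k : Fin 3, frobeniusNormSq (fderiv ℝ (fun z => fderiv ℝ v z (EuclideanSpace.basisFun (Fin 3) ℝ k)) x)) ≤
      M ^ 2 * (-(-((1 / 2) * ∫ x, deriv g (x 2) * frobeniusNormSq (fderiv ℝ (curl v) x)) -
          (∫ x, deriv (deriv g) (x 2) * ⟪fderiv ℝ (curl v) x (EuclideanSpace.single (2 : Fin 3) (1 : ℝ)), curl v x⟫ +
        deriv g (x 2) * ‖fderiv ℝ (curl v) x (EuclideanSpace.single (2 : Fin 3) (1 : ℝ))‖ ^ 2 +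
        deriv (deriv (deriv g)) (x 2) * ⟪fderiv ℝ (curl v) x (EuclideanSpace.single (2 : Fin 3) (1 : ℝ)),
          (-(v x - c) 1) • EuclideanSpace.single (0 : Fin 3) (1 : ℝ) + ((v x - c) 0) • EuclideanSpace.single (1 : Fin 3) (1 : ℝ)⟫ +
        deriv (deriv g) (x 2) * ⟪fderiv ℝ (curl v) x (EuclideanSpace.single (2 : Fin 3) (1 : ℝ)),
          fderiv ℝ (fun z : EuclideanSpace ℝ (Fin 3) =>
            (-(v z - c) 1) • EuclideanSpace.single (0 : Fin 3) (1 : ℝ) + ((v z - c) 0) • EuclideanSpace.single (1 : Fin 3) (1 : ℝ)) x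
            (EuclideanSpace.single (2 : Fin 3) (1 : ℝ))⟫ +
        ∑ i : Fin 3, (deriv (deriv g) (x 2) * ⟪fderiv ℝ (curl v) x (EuclideanSpace.basisFun (Fin 3) ℝ i),
            fderiv ℝ (fun z : EuclideanSpace ℝ (Fin 3) =>
              (-(v z - c) 1) • EuclideanSpace.single (0 : Fin 3) (1 : ℝ) + ((v z - c) 0) • EuclideanSpace.single (1 : Fin 3) (1 : ℝ)) x
              (EuclideanSpace.basisFun (Fin 3) ℝ i)⟫ +
          deriv g (x 2) * ⟪fderiv ℝ (curl v) x (EuclideanSpace.basisFun (Fin 3) ℝ i),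
            fderiv ℝ (fun y : EuclideanSpace ℝ (Fin 3) => fderiv ℝ (fun z : EuclideanSpace ℝ (Fin 3) =>
              (-(v z - c) 1) • EuclideanSpace.single (0 : Fin 3) (1 : ℝ) + ((v z - c) 0) • EuclideanSpace.single (1 : Fin 3) (1 : ℝ)) y
              (EuclideanSpace.basisFun (Fin 3) ℝ i)) x (EuclideanSpace.single (2 : Fin 3) (1 : ℝ))⟫)) +
          ∫ x, deriv (deriv g) (x 2) * (fderiv ℝ (curl v) x (EuclideanSpace.single (2 : Fin 3) (1 : ℝ)) 0 * fderiv ℝ v x (EuclideanSpace.single (1 : Fin 3) (1 : ℝ)) 2 -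
          fderiv ℝ (curl v) x (EuclideanSpace.single (2 : Fin 3) (1 : ℝ)) 1 * fderiv ℝ v x (EuclideanSpace.single (0 : Fin 3) (1 : ℝ)) 2) +
        deriv g (x 2) * ∑ i : Fin 3, (fderiv ℝ (curl v) x (EuclideanSpace.basisFun (Fin 3) ℝ i) 0 *
            fderiv ℝ (fun y => fderiv ℝ v y (EuclideanSpace.single (1 : Fin 3) (1 : ℝ))) x (EuclideanSpace.basisFun (Fin 3) ℝ i) 2 -
          fderiv ℝ (curl v) x (EuclideanSpace.basisFun (Fin 3) ℝ i) 1 *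
            fderiv ℝ (fun y => fderiv ℝ v y (EuclideanSpace.single (0 : Fin 3) (1 : ℝ))) x (EuclideanSpace.basisFun (Fin 3) ℝ i) 2))) +
      2 * (∫ x : EuclideanSpace ℝ (Fin 3), deriv g (x 2) * frobeniusNormSq (fderiv ℝ v x) ^ 2) +
      M ^ 2 * ((1 / 2) * |(∫ x : EuclideanSpace ℝ (Fin 3), deriv (deriv (deriv g)) (x 2) * ∑ k : Fin 3, (fderiv ℝ v x (EuclideanSpace.basisFun (Fin 3) ℝ k) 2) ^ 2)| + (1 / 2) * |(∫ x : EuclideanSpace ℝ (Fin 3), deriv (deriv (deriv g)) (x 2) * ‖curl v x‖ ^ 2)| + |(∫ x : EuclideanSpace ℝ (Fin 3), deriv (deriv (deriv g)) (x 2) * (fderiv ℝ v x (EuclideanSpace.single (2 : Fin 3) (1 : ℝ)) 2) ^ 2)| +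
        |(∫ x : EuclideanSpace ℝ (Fin 3), deriv (deriv (deriv g)) (x 2) * ⟪fderiv ℝ (curl v) x (EuclideanSpace.single (2 : Fin 3) (1 : ℝ)),
          (-(v x - c) 1) • EuclideanSpace.single (0 : Fin 3) (1 : ℝ) + ((v x - c) 0) • EuclideanSpace.single (1 : Fin 3) (1 : ℝ)⟫)| +
        |(∫ x : EuclideanSpace ℝ (Fin 3), deriv (deriv g) (x 2) * ⟪fderiv ℝ (curl v) x (EuclideanSpace.single (2 : Fin 3) (1 : ℝ)),
          fderiv ℝ (fun z : EuclideanSpace ℝ (Fin 3) => (-(v z - c) 1) • EuclideanSpace.single (0 : Fin 3) (1 : ℝ) + ((v z - c) 0) • EuclideanSpace.single (1 : Fin 3) (1 : ℝ)) x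
            (EuclideanSpace.single (2 : Fin 3) (1 : ℝ))⟫)| +
        |(∫ x : EuclideanSpace ℝ (Fin 3), ∑ i : Fin 3, deriv (deriv g) (x 2) * ⟪fderiv ℝ (curl v) x (EuclideanSpace.basisFun (Fin 3) ℝ i),
            fderiv ℝ (fun z : EuclideanSpace ℝ (Fin 3) => (-(v z - c) 1) • EuclideanSpace.single (0 : Fin 3) (1 : ℝ) + ((v z - c) 0) • EuclideanSpace.single (1 : Fin 3) (1 : ℝ)) x
              (EuclideanSpace.basisFun (Fin 3) ℝ i)⟫)| +
        |(∫ x : EuclideanSpace ℝ (Fin 3), deriv (deriv g) (x 2) * (fderiv ℝ (curl v) x (EuclideanSpace.single (2 : Fin 3) (1 : ℝ)) 0 * fderiv ℝ v x (EuclideanSpace.single (1 : Fin 3) (1 : ℝ)) 2 -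
          fderiv ℝ (curl v) x (EuclideanSpace.single (2 : Fin 3) (1 : ℝ)) 1 * fderiv ℝ v x (EuclideanSpace.single (0 : Fin 3) (1 : ℝ)) 2))|) := by
  rw [palinstrophyBracket_eq_secondOrder hv hdiv hg hK1 hK2 hK3 hT3 h1 h2 hslab]
  have lt2 : (2 : WithTop ℕ∞) ≤ ((⊤ : ℕ∞) : WithTop ℕ∞) := WithTop.coe_le_coe.mpr le_top
  have hv2 : ContDiff ℝ 2 v := hv.of_le lt2
  have hK0 : 0 ≤ K := (abs_nonneg _).trans (hK1 0)
  obtain ⟨iW2, iP2⟩ := integrable_sq_curl_and_fderiv hv h1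
  have iQ2 : Integrable (fun x : EuclideanSpace ℝ (Fin 3) => ‖iteratedFDeriv ℝ 2 v x‖ ^ 2) volume :=
    integrable_sq_norm_of_lintegral (hv.continuous_iteratedFDeriv (WithTop.coe_le_coe.mpr le_top)) h2
  have hg1 : ContDiff ℝ (⊤ : ℕ∞) (deriv g) := by simpa using hg.iterate_deriv 1
  have cg1 : Continuous fun x : EuclideanSpace ℝ (Fin 3) => deriv g (x 2) := hg1.continuous.comp (PiLp.continuous_apply 2 _ (2 : Fin 3))
  have hγK : ∀ x : EuclideanSpace ℝ (Fin 3), deriv g (x 2) ≤ K := fun x => (le_abs_self _).trans (hK1 _)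
  -- the Hessian-of-`V₂` line
  have hH := integral_weight_sq_hessian_two_le (w := fun x : EuclideanSpace ℝ (Fin 3) => deriv g (x 2)) hv hM hc0 hc1 hcM cg1 (fun x => hγ0 _) hγK hσ hB iP2 iQ2
  -- norm bookkeeping for second derivatives
  have nb : ∀ k : Fin 3, ‖EuclideanSpace.basisFun (Fin 3) ℝ k‖ = 1 := fun k => (EuclideanSpace.basisFun (Fin 3) ℝ).orthonormal.norm_eq_one k
  have n2 : ‖(EuclideanSpace.single (2 : Fin 3) (1 : ℝ) : EuclideanSpace ℝ (Fin 3))‖ = 1 := by rw [PiLp.norm_single, norm_one]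
  have n0 : ‖(EuclideanSpace.single (0 : Fin 3) (1 : ℝ) : EuclideanSpace ℝ (Fin 3))‖ = 1 := by rw [PiLp.norm_single, norm_one]
  have n1 : ‖(EuclideanSpace.single (1 : Fin 3) (1 : ℝ) : EuclideanSpace ℝ (Fin 3))‖ = 1 := by rw [PiLp.norm_single, norm_one]
  have hu : ∀ w : EuclideanSpace ℝ (Fin 3), ContDiff ℝ ∞ fun z => fderiv ℝ v z w := fun w =>
    (hv.fderiv_right (m := ∞) (by exact_mod_cast le_rfl)).clm_apply contDiff_const
  have nDu : ∀ (x w : EuclideanSpace ℝ (Fin 3)), ‖w‖ = 1 → ‖fderiv ℝ (fun y => fderiv ℝ v y w) x‖ ≤ ‖iteratedFDeriv ℝ 2 v x‖ := fun x w hw => by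
    rw [fderiv_fderiv_apply_eq hv2 x]
    have e1 : ‖fderiv ℝ (fderiv ℝ v) x‖ = ‖iteratedFDeriv ℝ 2 v x‖ := by
      rw [← norm_iteratedFDeriv_zero (𝕜 := ℝ) (f := fderiv ℝ (fderiv ℝ v)), norm_iteratedFDeriv_fderiv, norm_iteratedFDeriv_fderiv]
    rw [← e1]; simpa [hw] using (fderiv ℝ (fderiv ℝ v) x).le_opNorm w
  have nH : ∀ (x w u : EuclideanSpace ℝ (Fin 3)) (i : Fin 3), ‖w‖ = 1 → ‖u‖ = 1 → fderiv ℝ (fun y => fderiv ℝ v y w) x u i ^ 2 ≤ ‖iteratedFDeriv ℝ 2 v x‖ ^ 2 :=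
    fun x w u i hw hu' => by
    have h1 : |fderiv ℝ (fun y => fderiv ℝ v y w) x u i| ≤ ‖fderiv ℝ (fun y => fderiv ℝ v y w) x u‖ := abs_apply_le_norm _ i
    have h2 : ‖fderiv ℝ (fun y => fderiv ℝ v y w) x u‖ ≤ ‖iteratedFDeriv ℝ 2 v x‖ :=
      ((fderiv ℝ (fun y => fderiv ℝ v y w) x).le_opNorm u).trans (by rw [hu', mul_one]; exact nDu x w hw)
    rw [← sq_abs]; exact pow_le_pow_left₀ (abs_nonneg _) (h1.trans h2) 2
  have frob_le : ∀ (x w : EuclideanSpace ℝ (Fin 3)), ‖w‖ = 1 → frobeniusNormSq (fderiv ℝ (fun z => fderiv ℝ v z (w)) x) ≤ 3 * ‖iteratedFDeriv ℝ 2 v x‖ ^ 2 := fun x w hw => by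
    rw [frobeniusNormSq_eq_sum (EuclideanSpace.basisFun (Fin 3) ℝ)]
    have := sum_sq_norm_apply_le_card_mul_sq_opNorm (EuclideanSpace.basisFun (Fin 3) ℝ) (fderiv ℝ (fun z => fderiv ℝ v z w) x)
    rw [Fintype.card_fin, Nat.cast_ofNat] at this
    exact this.trans (by nlinarith [nDu x w hw, norm_nonneg (fderiv ℝ (fun y => fderiv ℝ v y w) x)])
  have hF0 : ∀ L : EuclideanSpace ℝ (Fin 3) →L[ℝ] EuclideanSpace ℝ (Fin 3), 0 ≤ frobeniusNormSq L := fun L => frobeniusNormSq_nonneg _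
  have cHc : ∀ (w u : EuclideanSpace ℝ (Fin 3)) (i : Fin 3), Continuous fun x => fderiv ℝ (fun y => fderiv ℝ v y w) x u i := fun w u i =>
    (EuclideanSpace.proj i : EuclideanSpace ℝ (Fin 3) →L[ℝ] ℝ).continuous.comp
      ((((hu w).fderiv_right (m := ∞) (by exact_mod_cast le_rfl)).clm_apply contDiff_const).continuous)
  have cFk : ∀ w : EuclideanSpace ℝ (Fin 3), Continuous fun x => frobeniusNormSq (fderiv ℝ (fun z => fderiv ℝ v z (w)) x) := fun w => continuous_frobeniusNormSq_fderiv (hu w) (by simp)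
  -- integrability of the Hessian pieces and of the Frobenius pieces
  have iH2 : Integrable (fun x : EuclideanSpace ℝ (Fin 3) => deriv g (x 2) * ∑ i : Fin 3, (fderiv ℝ (fun y => fderiv ℝ v y (EuclideanSpace.single (0 : Fin 3) (1 : ℝ))) x (EuclideanSpace.basisFun (Fin 3) ℝ i) 2 ^ 2 + fderiv ℝ (fun y => fderiv ℝ v y (EuclideanSpace.single (1 : Fin 3) (1 : ℝ))) x (EuclideanSpace.basisFun (Fin 3) ℝ i) 2 ^ 2)) volume := by
    refine (iQ2.const_mul (K * 6)).mono' (cg1.mul (continuous_finsetSum _ fun i _ => ((cHc _ _ 2).pow 2).add ((cHc _ _ 2).pow 2))).aestronglyMeasurable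
      (Eventually.of_forall fun x => ?_)
    rw [Real.norm_eq_abs, abs_mul, abs_of_nonneg (hγ0 _), abs_of_nonneg (Finset.sum_nonneg fun i _ => by positivity)]
    calc deriv g (x 2) * ∑ i : Fin 3, (fderiv ℝ (fun y => fderiv ℝ v y (EuclideanSpace.single (0 : Fin 3) (1 : ℝ))) x (EuclideanSpace.basisFun (Fin 3) ℝ i) 2 ^ 2 + fderiv ℝ (fun y => fderiv ℝ v y (EuclideanSpace.single (1 : Fin 3) (1 : ℝ))) x (EuclideanSpace.basisFun (Fin 3) ℝ i) 2 ^ 2) ≤ K * ∑ i : Fin 3, (‖iteratedFDeriv ℝ 2 v x‖ ^ 2 + ‖iteratedFDeriv ℝ 2 v x‖ ^ 2) :=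
          mul_le_mul (hγK x) (Finset.sum_le_sum fun i _ => add_le_add (nH x _ _ 2 n0 (nb i)) (nH x _ _ 2 n1 (nb i)))
            (Finset.sum_nonneg fun i _ => by positivity) hK0
      _ = K * 6 * ‖iteratedFDeriv ℝ 2 v x‖ ^ 2 := by simp; ring
  have iH0 : Integrable (fun x : EuclideanSpace ℝ (Fin 3) => deriv g (x 2) * ∑ i : Fin 3, (fderiv ℝ (fun y => fderiv ℝ v y (EuclideanSpace.basisFun (Fin 3) ℝ i)) x (EuclideanSpace.single (2 : Fin 3) (1 : ℝ)) 0 ^ 2 + fderiv ℝ (fun y => fderiv ℝ v y (EuclideanSpace.basisFun (Fin 3) ℝ i)) x (EuclideanSpace.single (2 : Fin 3) (1 : ℝ)) 1 ^ 2)) volume := by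
    refine (iQ2.const_mul (K * 6)).mono' (cg1.mul (continuous_finsetSum _ fun i _ => ((cHc _ _ 0).pow 2).add ((cHc _ _ 1).pow 2))).aestronglyMeasurable
      (Eventually.of_forall fun x => ?_)
    rw [Real.norm_eq_abs, abs_mul, abs_of_nonneg (hγ0 _), abs_of_nonneg (Finset.sum_nonneg fun i _ => by positivity)]
    calc deriv g (x 2) * ∑ i : Fin 3, (fderiv ℝ (fun y => fderiv ℝ v y (EuclideanSpace.basisFun (Fin 3) ℝ i)) x (EuclideanSpace.single (2 : Fin 3) (1 : ℝ)) 0 ^ 2 + fderiv ℝ (fun y => fderiv ℝ v y (EuclideanSpace.basisFun (Fin 3) ℝ i)) x (EuclideanSpace.single (2 : Fin 3) (1 : ℝ)) 1 ^ 2) ≤ K * ∑ i : Fin 3, (‖iteratedFDeriv ℝ 2 v x‖ ^ 2 + ‖iteratedFDeriv ℝ 2 v x‖ ^ 2) :=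
          mul_le_mul (hγK x) (Finset.sum_le_sum fun i _ => add_le_add (nH x _ _ 0 (nb i) n2) (nH x _ _ 1 (nb i) n2))
            (Finset.sum_nonneg fun i _ => by positivity) hK0
      _ = K * 6 * ‖iteratedFDeriv ℝ 2 v x‖ ^ 2 := by simp; ring
  have iF2 : Integrable (fun x : EuclideanSpace ℝ (Fin 3) => deriv g (x 2) * ∑ k : Fin 3, frobeniusNormSq (fderiv ℝ (fun z => fderiv ℝ v z (EuclideanSpace.basisFun (Fin 3) ℝ k)) x)) volume := by
    refine (iQ2.const_mul (K * 9)).mono' (cg1.mul (continuous_finsetSum _ fun k _ => cFk _)).aestronglyMeasurable (Eventually.of_forall fun x => ?_)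
    rw [Real.norm_eq_abs, abs_mul, abs_of_nonneg (hγ0 _), abs_of_nonneg (Finset.sum_nonneg fun k _ => hF0 _)]
    calc deriv g (x 2) * ∑ k : Fin 3, frobeniusNormSq (fderiv ℝ (fun z => fderiv ℝ v z (EuclideanSpace.basisFun (Fin 3) ℝ k)) x) ≤ K * ∑ k : Fin 3, 3 * ‖iteratedFDeriv ℝ 2 v x‖ ^ 2 :=
          mul_le_mul (hγK x) (Finset.sum_le_sum fun k _ => frob_le x _ (nb k)) (Finset.sum_nonneg fun k _ => hF0 _) hK0
      _ = K * 9 * ‖iteratedFDeriv ℝ 2 v x‖ ^ 2 := by simp; ring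
  have iF01 : Integrable (fun x : EuclideanSpace ℝ (Fin 3) => deriv g (x 2) * (frobeniusNormSq (fderiv ℝ (fun z => fderiv ℝ v z (EuclideanSpace.single (0 : Fin 3) (1 : ℝ))) x) + frobeniusNormSq (fderiv ℝ (fun z => fderiv ℝ v z (EuclideanSpace.single (1 : Fin 3) (1 : ℝ))) x))) volume := by
    refine (iQ2.const_mul (K * 6)).mono' (cg1.mul ((cFk _).add (cFk _))).aestronglyMeasurable (Eventually.of_forall fun x => ?_)
    rw [Real.norm_eq_abs, abs_mul, abs_of_nonneg (hγ0 _), abs_of_nonneg (add_nonneg (hF0 _) (hF0 _))]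
    calc deriv g (x 2) * (frobeniusNormSq (fderiv ℝ (fun z => fderiv ℝ v z (EuclideanSpace.single (0 : Fin 3) (1 : ℝ))) x) + frobeniusNormSq (fderiv ℝ (fun z => fderiv ℝ v z (EuclideanSpace.single (1 : Fin 3) (1 : ℝ))) x)) ≤ K * (3 * ‖iteratedFDeriv ℝ 2 v x‖ ^ 2 + 3 * ‖iteratedFDeriv ℝ 2 v x‖ ^ 2) :=
          mul_le_mul (hγK x) (add_le_add (frob_le x _ n0) (frob_le x _ n1)) (add_nonneg (hF0 _) (hF0 _)) hK0
      _ = K * 6 * ‖iteratedFDeriv ℝ 2 v x‖ ^ 2 := by ring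
  -- `HESS = H2 − H0`, `H0 ≥ 0`, `F3 ≥ 0`, `∫g′(frob₀ + frob₁) ≤ F2`
  have eH : (∫ x : EuclideanSpace ℝ (Fin 3), deriv g (x 2) * ∑ i : Fin 3, (fderiv ℝ (fun y => fderiv ℝ v y (EuclideanSpace.single (0 : Fin 3) (1 : ℝ))) x (EuclideanSpace.basisFun (Fin 3) ℝ i) 2 ^ 2 + fderiv ℝ (fun y => fderiv ℝ v y (EuclideanSpace.single (1 : Fin 3) (1 : ℝ))) x (EuclideanSpace.basisFun (Fin 3) ℝ i) 2 ^ 2 - fderiv ℝ (fun y => fderiv ℝ v y (EuclideanSpace.basisFun (Fin 3) ℝ i)) x (EuclideanSpace.single (2 : Fin 3) (1 : ℝ)) 0 ^ 2 - fderiv ℝ (fun y => fderiv ℝ v y (EuclideanSpace.basisFun (Fin 3) ℝ i)) x (EuclideanSpace.single (2 : Fin 3) (1 : ℝ)) 1 ^ 2)) = (∫ x : EuclideanSpace ℝ (Fin 3), deriv g (x 2) * ∑ i : Fin 3, (fderiv ℝ (fun y => fderiv ℝ v y (EuclideanSpace.single (0 : Fin 3) (1 : ℝ))) x (EuclideanSpace.basisFun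 (Fin 3) ℝ i) 2 ^ 2 + fderiv ℝ (fun y => fderiv ℝ v y (EuclideanSpace.single (1 : Fin 3) (1 : ℝ))) x (EuclideanSpace.basisFun (Fin 3) ℝ i) 2 ^ 2)) - (∫ x : EuclideanSpace ℝ (Fin 3), deriv g (x 2) * ∑ i : Fin 3, (fderiv ℝ (fun y => fderiv ℝ v y (EuclideanSpace.basisFun (Fin 3) ℝ i)) x (EuclideanSpace.single (2 : Fin 3) (1 : ℝ)) 0 ^ 2 + fderiv ℝ (fun y => fderiv ℝ v y (EuclideanSpace.basisFun (Fin 3) ℝ i)) x (EuclideanSpace.single (2 : Fin 3) (1 : ℝ)) 1 ^ 2)) := by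
    rw [← integral_sub iH2 iH0]
    refine integral_congr_ae (Eventually.of_forall fun x => ?_)
    simp only
    rw [← mul_sub, ← Finset.sum_sub_distrib]
    congr 1
    exact Finset.sum_congr rfl fun i _ => by ring
  have hH0 : 0 ≤ (∫ x : EuclideanSpace ℝ (Fin 3), deriv g (x 2) * ∑ i : Fin 3, (fderiv ℝ (fun y => fderiv ℝ v y (EuclideanSpace.basisFun (Fin 3) ℝ i)) x (EuclideanSpace.single (2 : Fin 3) (1 : ℝ)) 0 ^ 2 + fderiv ℝ (fun y => fderiv ℝ v y (EuclideanSpace.basisFun (Fin 3) ℝ i)) x (EuclideanSpace.single (2 : Fin 3) (1 : ℝ)) 1 ^ 2)) := integral_nonneg fun x => mul_nonneg (hγ0 _) (Finset.sum_nonneg fun i _ => by positivity)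
  have hF3 : 0 ≤ (∫ x : EuclideanSpace ℝ (Fin 3), deriv g (x 2) * frobeniusNormSq (fderiv ℝ (fun z => fderiv ℝ v z (EuclideanSpace.single (2 : Fin 3) (1 : ℝ))) x)) := integral_nonneg fun x => mul_nonneg (hγ0 _) (hF0 _)
  have hF2 : 0 ≤ (∫ x : EuclideanSpace ℝ (Fin 3), deriv g (x 2) * ∑ k : Fin 3, frobeniusNormSq (fderiv ℝ (fun z => fderiv ℝ v z (EuclideanSpace.basisFun (Fin 3) ℝ k)) x)) := integral_nonneg fun x => mul_nonneg (hγ0 _) (Finset.sum_nonneg fun k _ => hF0 _)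
  have hb0 : EuclideanSpace.basisFun (Fin 3) ℝ 0 = EuclideanSpace.single (0 : Fin 3) (1 : ℝ) := by simp [EuclideanSpace.basisFun_apply]
  have hb1 : EuclideanSpace.basisFun (Fin 3) ℝ 1 = EuclideanSpace.single (1 : Fin 3) (1 : ℝ) := by simp [EuclideanSpace.basisFun_apply]
  have h01 : (∫ x : EuclideanSpace ℝ (Fin 3), deriv g (x 2) * (frobeniusNormSq (fderiv ℝ (fun z => fderiv ℝ v z (EuclideanSpace.single (0 : Fin 3) (1 : ℝ))) x) + frobeniusNormSq (fderiv ℝ (fun z => fderiv ℝ v z (EuclideanSpace.single (1 : Fin 3) (1 : ℝ))) x))) ≤ (∫ x : EuclideanSpace ℝ (Fin 3), deriv g (x 2) * ∑ k : Fin 3, frobeniusNormSq (fderiv ℝ (fun z => fderiv ℝ v z (EuclideanSpace.basisFun (Fin 3) ℝ k)) x)) := by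
    refine integral_mono iF01 iF2 fun x => ?_
    refine mul_le_mul_of_nonneg_left ?_ (hγ0 _)
    rw [Fin.sum_univ_three, hb0, hb1]
    linarith [hF0 (fderiv ℝ (fun z => fderiv ℝ v z (EuclideanSpace.basisFun (Fin 3) ℝ 2)) x)]
  -- absolute values of the lower-order terms, weighted by `M²`
  have hM2 : 0 ≤ M ^ 2 := sq_nonneg M
  have b1 : 0 ≤ M ^ 2 * (|(∫ x : EuclideanSpace ℝ (Fin 3), deriv (deriv (deriv g)) (x 2) * ∑ k : Fin 3, (fderiv ℝ v x (EuclideanSpace.basisFun (Fin 3) ℝ k) 2) ^ 2)| - (∫ x : EuclideanSpace ℝ (Fin 3), deriv (deriv (deriv g)) (x 2) * ∑ k : Fin 3, (fderiv ℝ v x (EuclideanSpace.basisFun (Fin 3) ℝ k) 2) ^ 2)) := mul_nonneg hM2 (sub_nonneg.2 (le_abs_self _))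
  have b2 : 0 ≤ M ^ 2 * (|(∫ x : EuclideanSpace ℝ (Fin 3), deriv (deriv (deriv g)) (x 2) * ‖curl v x‖ ^ 2)| - (∫ x : EuclideanSpace ℝ (Fin 3), deriv (deriv (deriv g)) (x 2) * ‖curl v x‖ ^ 2)) := mul_nonneg hM2 (sub_nonneg.2 (le_abs_self _))
  have b3 : 0 ≤ M ^ 2 * (|(∫ x : EuclideanSpace ℝ (Fin 3), deriv (deriv (deriv g)) (x 2) * (fderiv ℝ v x (EuclideanSpace.single (2 : Fin 3) (1 : ℝ)) 2) ^ 2)| - (∫ x : EuclideanSpace ℝ (Fin 3), deriv (deriv (deriv g)) (x 2) * (fderiv ℝ v x (EuclideanSpace.single (2 : Fin 3) (1 : ℝ)) 2) ^ 2)) := mul_nonneg hM2 (sub_nonneg.2 (le_abs_self _))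
  have b4 : 0 ≤ M ^ 2 * ((∫ x : EuclideanSpace ℝ (Fin 3), deriv (deriv (deriv g)) (x 2) * ⟪fderiv ℝ (curl v) x (EuclideanSpace.single (2 : Fin 3) (1 : ℝ)),
          (-(v x - c) 1) • EuclideanSpace.single (0 : Fin 3) (1 : ℝ) + ((v x - c) 0) • EuclideanSpace.single (1 : Fin 3) (1 : ℝ)⟫) + |(∫ x : EuclideanSpace ℝ (Fin 3), deriv (deriv (deriv g)) (x 2) * ⟪fderiv ℝ (curl v) x (EuclideanSpace.single (2 : Fin 3) (1 : ℝ)),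
          (-(v x - c) 1) • EuclideanSpace.single (0 : Fin 3) (1 : ℝ) + ((v x - c) 0) • EuclideanSpace.single (1 : Fin 3) (1 : ℝ)⟫)|) := mul_nonneg hM2 (by linarith [neg_abs_le (∫ x : EuclideanSpace ℝ (Fin 3), deriv (deriv (deriv g)) (x 2) * ⟪fderiv ℝ (curl v) x (EuclideanSpace.single (2 : Fin 3) (1 : ℝ)),
          (-(v x - c) 1) • EuclideanSpace.single (0 : Fin 3) (1 : ℝ) + ((v x - c) 0) • EuclideanSpace.single (1 : Fin 3) (1 : ℝ)⟫)])
  have b5 : 0 ≤ M ^ 2 * ((∫ x : EuclideanSpace ℝ (Fin 3), deriv (deriv g) (x 2) * ⟪fderiv ℝ (curl v) x (EuclideanSpace.single (2 : Fin 3) (1 : ℝ)),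
          fderiv ℝ (fun z : EuclideanSpace ℝ (Fin 3) => (-(v z - c) 1) • EuclideanSpace.single (0 : Fin 3) (1 : ℝ) + ((v z - c) 0) • EuclideanSpace.single (1 : Fin 3) (1 : ℝ)) x
            (EuclideanSpace.single (2 : Fin 3) (1 : ℝ))⟫) + |(∫ x : EuclideanSpace ℝ (Fin 3), deriv (deriv g) (x 2) * ⟪fderiv ℝ (curl v) x (EuclideanSpace.single (2 : Fin 3) (1 : ℝ)),
          fderiv ℝ (fun z : EuclideanSpace ℝ (Fin 3) => (-(v z - c) 1) • EuclideanSpace.single (0 : Fin 3) (1 : ℝ) + ((v z - c) 0) • EuclideanSpace.single (1 : Fin 3) (1 : ℝ)) x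
            (EuclideanSpace.single (2 : Fin 3) (1 : ℝ))⟫)|) := mul_nonneg hM2 (by linarith [neg_abs_le (∫ x : EuclideanSpace ℝ (Fin 3), deriv (deriv g) (x 2) * ⟪fderiv ℝ (curl v) x (EuclideanSpace.single (2 : Fin 3) (1 : ℝ)),
          fderiv ℝ (fun z : EuclideanSpace ℝ (Fin 3) => (-(v z - c) 1) • EuclideanSpace.single (0 : Fin 3) (1 : ℝ) + ((v z - c) 0) • EuclideanSpace.single (1 : Fin 3) (1 : ℝ)) x
            (EuclideanSpace.single (2 : Fin 3) (1 : ℝ))⟫)])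
  have b6 : 0 ≤ M ^ 2 * ((∫ x : EuclideanSpace ℝ (Fin 3), ∑ i : Fin 3, deriv (deriv g) (x 2) * ⟪fderiv ℝ (curl v) x (EuclideanSpace.basisFun (Fin 3) ℝ i),
            fderiv ℝ (fun z : EuclideanSpace ℝ (Fin 3) => (-(v z - c) 1) • EuclideanSpace.single (0 : Fin 3) (1 : ℝ) + ((v z - c) 0) • EuclideanSpace.single (1 : Fin 3) (1 : ℝ)) x
              (EuclideanSpace.basisFun (Fin 3) ℝ i)⟫) + |(∫ x : EuclideanSpace ℝ (Fin 3), ∑ i : Fin 3, deriv (deriv g) (x 2) * ⟪fderiv ℝ (curl v) x (EuclideanSpace.basisFun (Fin 3) ℝ i),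
            fderiv ℝ (fun z : EuclideanSpace ℝ (Fin 3) => (-(v z - c) 1) • EuclideanSpace.single (0 : Fin 3) (1 : ℝ) + ((v z - c) 0) • EuclideanSpace.single (1 : Fin 3) (1 : ℝ)) x
              (EuclideanSpace.basisFun (Fin 3) ℝ i)⟫)|) :=
    mul_nonneg hM2 (by linarith [neg_abs_le (∫ x : EuclideanSpace ℝ (Fin 3), ∑ i : Fin 3, deriv (deriv g) (x 2) * ⟪fderiv ℝ (curl v) x (EuclideanSpace.basisFun (Fin 3) ℝ i),
            fderiv ℝ (fun z : EuclideanSpace ℝ (Fin 3) => (-(v z - c) 1) • EuclideanSpace.single (0 : Fin 3) (1 : ℝ) + ((v z - c) 0) • EuclideanSpace.single (1 : Fin 3) (1 : ℝ)) x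
              (EuclideanSpace.basisFun (Fin 3) ℝ i)⟫)])
  have b8 : 0 ≤ M ^ 2 * (|(∫ x : EuclideanSpace ℝ (Fin 3), deriv (deriv g) (x 2) * (fderiv ℝ (curl v) x (EuclideanSpace.single (2 : Fin 3) (1 : ℝ)) 0 * fderiv ℝ v x (EuclideanSpace.single (1 : Fin 3) (1 : ℝ)) 2 -
          fderiv ℝ (curl v) x (EuclideanSpace.single (2 : Fin 3) (1 : ℝ)) 1 * fderiv ℝ v x (EuclideanSpace.single (0 : Fin 3) (1 : ℝ)) 2))| - (∫ x : EuclideanSpace ℝ (Fin 3), deriv (deriv g) (x 2) * (fderiv ℝ (curl v) x (EuclideanSpace.single (2 : Fin 3) (1 : ℝ)) 0 * fderiv ℝ v x (EuclideanSpace.single (1 : Fin 3) (1 : ℝ)) 2 -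
          fderiv ℝ (curl v) x (EuclideanSpace.single (2 : Fin 3) (1 : ℝ)) 1 * fderiv ℝ v x (EuclideanSpace.single (0 : Fin 3) (1 : ℝ)) 2))) := mul_nonneg hM2 (sub_nonneg.2 (le_abs_self _))
  have bF3 : 0 ≤ M ^ 2 * (∫ x : EuclideanSpace ℝ (Fin 3), deriv g (x 2) * frobeniusNormSq (fderiv ℝ (fun z => fderiv ℝ v z (EuclideanSpace.single (2 : Fin 3) (1 : ℝ))) x)) := mul_nonneg hM2 hF3
  have bH0 : 0 ≤ M ^ 2 * (∫ x : EuclideanSpace ℝ (Fin 3), deriv g (x 2) * ∑ i : Fin 3, (fderiv ℝ (fun y => fderiv ℝ v y (EuclideanSpace.basisFun (Fin 3) ℝ i)) x (EuclideanSpace.single (2 : Fin 3) (1 : ℝ)) 0 ^ 2 + fderiv ℝ (fun y => fderiv ℝ v y (EuclideanSpace.basisFun (Fin 3) ℝ i)) x (EuclideanSpace.single (2 : Fin 3) (1 : ℝ)) 1 ^ 2)) := mul_nonneg hM2 hH0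
  -- absorb the Hessian-of-`V₂` line: `M²·H2 ≤ 2∫g′|Dv|⁴_F + (M²/4)·F2`
  have s1 : 2 * σ ^ 2 * (∫ x : EuclideanSpace ℝ (Fin 3), deriv g (x 2) * (frobeniusNormSq (fderiv ℝ (fun z => fderiv ℝ v z (EuclideanSpace.single (0 : Fin 3) (1 : ℝ))) x) + frobeniusNormSq (fderiv ℝ (fun z => fderiv ℝ v z (EuclideanSpace.single (1 : Fin 3) (1 : ℝ))) x))) ≤ 2 * σ ^ 2 * (∫ x : EuclideanSpace ℝ (Fin 3), deriv g (x 2) * ∑ k : Fin 3, frobeniusNormSq (fderiv ℝ (fun z => fderiv ℝ v z (EuclideanSpace.basisFun (Fin 3) ℝ k)) x)) := mul_le_mul_of_nonneg_left h01 (by positivity)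
  have s2 : 2 * σ ^ 2 * (∫ x : EuclideanSpace ℝ (Fin 3), deriv g (x 2) * ∑ k : Fin 3, frobeniusNormSq (fderiv ℝ (fun z => fderiv ℝ v z (EuclideanSpace.basisFun (Fin 3) ℝ k)) x)) ≤ (M ^ 2 / 4) * (∫ x : EuclideanSpace ℝ (Fin 3), deriv g (x 2) * ∑ k : Fin 3, frobeniusNormSq (fderiv ℝ (fun z => fderiv ℝ v z (EuclideanSpace.basisFun (Fin 3) ℝ k)) x)) := mul_le_mul_of_nonneg_right (by linarith) hF2
  have key : M ^ 2 * (∫ x : EuclideanSpace ℝ (Fin 3), deriv g (x 2) * ∑ i : Fin 3, (fderiv ℝ (fun y => fderiv ℝ v y (EuclideanSpace.single (0 : Fin 3) (1 : ℝ))) x (EuclideanSpace.basisFun (Fin 3) ℝ i) 2 ^ 2 + fderiv ℝ (fun y => fderiv ℝ v y (EuclideanSpace.single (1 : Fin 3) (1 : ℝ))) x (EuclideanSpace.basisFun (Fin 3) ℝ i) 2 ^ 2)) ≤ 2 * (∫ x : EuclideanSpace ℝ (Fin 3), deriv g (x 2) * frobeniusNormSq (fderiv ℝ v x) ^ 2)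 + (M ^ 2 / 4) * (∫ x : EuclideanSpace ℝ (Fin 3), deriv g (x 2) * ∑ k : Fin 3, frobeniusNormSq (fderiv ℝ (fun z => fderiv ℝ v z (EuclideanSpace.basisFun (Fin 3) ℝ k)) x)) := by linarith [hH, s1, s2]
  rw [eH]
  linarith [key, b1, b2, b3, b4, b5, b6, b8, bF3, bH0]

end ExtremiserLiouville

end Summit.NavierStokesRegularity.NavierStokesRegularity.Theorems

end
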